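import Summits.QuantumFields.YangMills.Theorems.BalabanUVNodesN15KingModelSrcDivForwardRows
import Summits.QuantumFields.YangMills.Theorems.BalabanUVNodesN15KingModelSrcDivMixedLog
import HarnessLib

/-!
# BalabanUVNodes ∕ N15 — THE KING-MODEL RUNG, PROGRAMME Y (the dressed SOURCE-DIVERGENCE entry of the King jet), FILE 70a:
# THE LETTERS OF THE BY-PARTS FIXED POINT AT ONE `(δ, β)` — the third-entry operator `A₀⁻¹N∇*_κ ⊗ 1` (plain, η-defect), the forward source differences
# `S̃_μ = A₀⁻¹N∇_μ ⊗ 1` (plain, η-defect, cell oscillation) and the bare mixed rows `N∇_μ′A₀⁻¹N∇*_μ ⊗ 1` (`β(K+1)`), uniformly in `K ≥ 1`, `n ≥ 1`, the volume and the mass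

WHO ∕ WHEN.  Cell `pub-ymgap`, seat `pub-ymgap-dag-n15-d` (R134, N15 NE2 s3 = King-model rung, g22); `--kind proof --supports stmt-QuantumFields-27366 --as helper`
(K3⁸; count-neutral).  THEOREMS ONLY (0 `def`).  PACKAGING over dag-n15-e Σ-a (`hasMaj_kingSOp`, `hasMaj_kingSOp_fine`), dag-n15-a K-A (`hasMaj_idef_tensorId_kingSOp`,
`hasMaj_weaken`, `blockOf_comp_underPtN`), this seat's FILE 67 (`hasMaj_tensorId_kingSOpFwd_coarse∕_fine`, `hasMaj_idef_tensorId_kingSOpFwd`,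
`hasMaj_kingSOpFwd_comp_idef_mulOp_blockAvg`) and FILE 68 (`hasMaj_sD_tensorId_kingSOp`) BY NAME; nothing in the tree is modified.

WHY.  FILE 70c runs `T4EtaRateDefect.idef_neumann_majorant_flat` on the by-parts fixed point of FILE 69; the device wants every row at ONE decay rate.  This file is the
`kingJet_uniform_letters`-style package of the rows programme Y adds to K-A's nine.

WHAT.  ★ `srcDiv_uniform_letters` — `∃ δ β > 0` such that for every `K ≥ 1`, `n ≥ 1`, cube `M_μ = 2L^e`, mass `0 < m² ≤ m₀²`: (1)–(2) plain rows of `kingSOp_κ ⊗ 1` coarse∕fine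
(`βe^{−δd}`); (3) its η-defect (`β(L^K)^{−γ∕2}e^{−δd}`); (4)–(5) plain rows of `S̃_μ` coarse∕fine; (6) its η-defect; (7) its cell-oscillation row (`βr(L^K)^{−1∕(8(d+1))}e^{−δd}` for
`|c′| ≤ r`); (8) the bare mixed rows, coarse (`β(K+1)e^{−δd}`).

HONEST FRAMING ∕ LIMITS.  Packaging only; King's `A = 0` MODEL (template literature [King1986] (2.13)–(2.17) p.653, (4.1)–(4.5) p.670) — NOT Bałaban's covariant `G(U)`;
[Balaban1985BackgroundPropagators] (3.42)–(3.44) pp.397–398 cited as SHAPE only.  NE2⁺ NOT PRINTED ∕ NOT proved; no statement of record touched; N15 NOT discharged; K3⁸ OPEN;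
counts UNMOVED (typed 28∕28 · discharged 5∕27); one finite torus per index — NOT ℝ⁴ ∕ infinite volume ∕ OS ∕ mass gap ∕ Clay.
-/

noncomputable section

open scoped BigOperators Matrix
open Finset

namespace Summit.QuantumFields.YangMills.BalabanUVNodes.N15.KingModel.SrcDiv

open Literature.MathematicalPhysics.QuantumFieldTheory.Balaban1983to89
open Literature.MathematicalPhysics.QuantumFieldTheory.Balaban1983to89.B11SectG (BlockNorm HasMaj)
open Literature.MathematicalPhysics.QuantumFieldTheory.Balaban1983to89.T4EtaRateDefect (idef)
open Literature.MathematicalPhysics.QuantumFieldTheory.Balaban1983to89.T4EtaRateCoeffDefect (pull blockAvg)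
open Literature.MathematicalPhysics.QuantumFieldTheory.Balaban1983to89.B6Prop26Gluing (mulOp)
open Literature.MathematicalPhysics.QuantumFieldTheory.Balaban1983to89.B5Prop11Plancherel (Tor fine unitVec)
open Literature.MathematicalPhysics.QuantumFieldTheory.King1986.Torus (blockOf tdistT tdistT_nonneg)
open Literature.MathematicalPhysics.QuantumFieldTheory.Balaban1983to89.B6UnitTorusCarrier (unitTorusGeo)
open Summit.QuantumFields.YangMills.BalabanUVNodes.N15.VectorPiece (kingPrV blkFine tensorId hasMaj_tensorId)
open Summit.QuantumFields.YangMills.BalabanUVNodes.N15.TwoGrid (symbOp sD sTinv)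
open Summit.QuantumFields.YangMills.BalabanUVNodes.N15.TwoGrid.KingJet (blockOf_comp_underPtN hasMaj_idef_tensorId_kingSOp hasMaj_weaken hasMaj_weaken₂)
open Summit.QuantumFields.YangMills.BalabanUVNodes.N15KingModelRung.Curved (kingGOp kingSOp hasMaj_kingSOp hasMaj_kingSOp_fine)

variable (d : ℕ) (L : ℕ) [NeZero L]

/-- ★ **THE LETTERS OF PROGRAMME Y AT ONE `(δ, β)`** (module docstring, WHAT (1)–(8)). [cite: Balaban1985BackgroundPropagators, Thm 3.1 (3.42)–(3.44) pp.397–398 (shapes);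
King1986, (2.13)–(2.17) p.653, Prop. 3.8 (3.71) p.664, Prop. 3.9 (3.73) p.665, (4.1)–(4.5) p.670] -/
theorem srcDiv_uniform_letters (hLodd : Odd L) (hL : 2 ≤ L) {a : ℝ} (ha : 0 < a) {m0sq : ℝ} (hm0 : 0 ≤ m0sq) {γ : ℝ} (hγ0 : 0 ≤ γ) (hγ1 : γ < 1) :
    ∃ δ β : ℝ, 0 < δ ∧ 0 < β ∧ ∀ (K : ℕ), 1 ≤ K → ∀ (n : ℕ), 1 ≤ n → ∀ (e : ℕ) (M : Fin (d + 1) → ℕ) [∀ μ, NeZero (M μ)], (∀ μ, M μ = 2 * L ^ e) →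
      ∀ (msq : ℝ), 0 < msq → msq ≤ m0sq →
      (∀ κ, HasMaj (BlockNorm.ofBlocks (unitTorusGeo L K M) (blkFine L K M)) (BlockNorm.ofBlocks (unitTorusGeo L K M) (blkFine L K M))
          (tensorId (Fin (d + 1)) (kingSOp L a msq K (L ^ K) M κ)) (fun y y' => β * Real.exp (-(δ * tdistT M y y')))) ∧
      (∀ κ, HasMaj (BlockNorm.ofBlocks (unitTorusGeo L K M) (fun i : Tor (fine (L ^ n * L ^ K) M) × Fin (d + 1) => blockOf (L ^ n * L ^ K) M i.1))
          (BlockNorm.ofBlocks (unitTorusGeo L K M) (fun i : Tor (fine (L ^ n * L ^ K) M) × Fin (d + 1) => blockOf (L ^ n * L ^ K) M i.1))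
          (tensorId (Fin (d + 1)) (kingSOp L a msq (K + n) (L ^ n * L ^ K) M κ)) (fun y y' => β * Real.exp (-(δ * tdistT M y y')))) ∧
      (∀ κ, HasMaj (BlockNorm.ofBlocks (unitTorusGeo L K M) (blkFine L K M))
          (BlockNorm.ofBlocks (unitTorusGeo L K M) (fun i : Tor (fine (L ^ n * L ^ K) M) × Fin (d + 1) => blockOf (L ^ n * L ^ K) M i.1))
          (idef (pull (kingPrV L K n M)) (pull (kingPrV L K n M)) (tensorId (Fin (d + 1)) (kingSOp L a msq (K + n) (L ^ n * L ^ K) M κ))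
            (tensorId (Fin (d + 1)) (kingSOp L a msq K (L ^ K) M κ)))
          (fun y y' => β * ((L : ℝ) ^ K) ^ (-(γ / 2)) * Real.exp (-(δ * tdistT M y y')))) ∧
      (∀ μ, HasMaj (BlockNorm.ofBlocks (unitTorusGeo L K M) (blkFine L K M)) (BlockNorm.ofBlocks (unitTorusGeo L K M) (blkFine L K M))
          (tensorId (Fin (d + 1)) (kingGOp L a msq K (L ^ K) M ∘ₗ
            (((L ^ K : ℕ) : ℝ) • (pull (fun y : Tor (fine (L ^ K) M) => y + unitVec (fine (L ^ K) M) μ) - LinearMap.id))))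
          (fun y y' => β * Real.exp (-(δ * tdistT M y y')))) ∧
      (∀ μ, HasMaj (BlockNorm.ofBlocks (unitTorusGeo L K M) (fun i : Tor (fine (L ^ n * L ^ K) M) × Fin (d + 1) => blockOf (L ^ n * L ^ K) M i.1))
          (BlockNorm.ofBlocks (unitTorusGeo L K M) (fun i : Tor (fine (L ^ n * L ^ K) M) × Fin (d + 1) => blockOf (L ^ n * L ^ K) M i.1))
          (tensorId (Fin (d + 1)) (kingGOp L a msq (K + n) (L ^ n * L ^ K) M ∘ₗ
            (((L ^ n * L ^ K : ℕ) : ℝ) • (pull (fun y : Tor (fine (L ^ n * L ^ K) M) => y + unitVec (fine (L ^ n * L ^ K) M) μ) - LinearMap.id))))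
          (fun y y' => β * Real.exp (-(δ * tdistT M y y')))) ∧
      (∀ μ, HasMaj (BlockNorm.ofBlocks (unitTorusGeo L K M) (blkFine L K M))
          (BlockNorm.ofBlocks (unitTorusGeo L K M) (fun i : Tor (fine (L ^ n * L ^ K) M) × Fin (d + 1) => blockOf (L ^ n * L ^ K) M i.1))
          (idef (pull (kingPrV L K n M)) (pull (kingPrV L K n M))
            (tensorId (Fin (d + 1)) (kingGOp L a msq (K + n) (L ^ n * L ^ K) M ∘ₗ
              (((L ^ n * L ^ K : ℕ) : ℝ) • (pull (fun y : Tor (fine (L ^ n * L ^ K) M) => y + unitVec (fine (L ^ n * L ^ K) M) μ) - LinearMap.id))))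
            (tensorId (Fin (d + 1)) (kingGOp L a msq K (L ^ K) M ∘ₗ
              (((L ^ K : ℕ) : ℝ) • (pull (fun y : Tor (fine (L ^ K) M) => y + unitVec (fine (L ^ K) M) μ) - LinearMap.id)))))
          (fun y y' => β * ((L : ℝ) ^ K) ^ (-(γ / 2)) * Real.exp (-(δ * tdistT M y y')))) ∧
      (∀ (μ : Fin (d + 1)) (c' : Tor (fine (L ^ n * L ^ K) M) × Fin (d + 1) → ℝ) (r : ℝ), 0 ≤ r → (∀ z, |c' z| ≤ r) →
        HasMaj (BlockNorm.ofBlocks (unitTorusGeo L K M) (blkFine L K M))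
          (BlockNorm.ofBlocks (unitTorusGeo L K M) (fun p : Tor (fine (L ^ n * L ^ K) M) × Fin (d + 1) => blockOf (L ^ n * L ^ K) M p.1))
          (tensorId (Fin (d + 1)) (kingGOp L a msq (K + n) (L ^ n * L ^ K) M ∘ₗ
              (((L ^ n * L ^ K : ℕ) : ℝ) • (pull (fun y : Tor (fine (L ^ n * L ^ K) M) => y + unitVec (fine (L ^ n * L ^ K) M) μ) - LinearMap.id))) ∘ₗ
            idef (pull (kingPrV L K n M)) (pull (kingPrV L K n M)) (mulOp c') (mulOp (blockAvg (kingPrV L K n M) c')))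
          (fun y y' => β * r * ((L ^ K : ℕ) : ℝ) ^ (-(1 / (8 * ((d : ℝ) + 1)))) * Real.exp (-(δ * tdistT M y y')))) ∧
      (∀ μ μ', HasMaj (BlockNorm.ofBlocks (unitTorusGeo L K M) (blkFine L K M)) (BlockNorm.ofBlocks (unitTorusGeo L K M) (blkFine L K M))
          (symbOp M (L ^ K) (sD M (L ^ K) μ' ((L ^ K : ℕ) : ℝ)) ∘ₗ tensorId (Fin (d + 1)) (kingSOp L a msq K (L ^ K) M μ))
          (fun y y' => β * (((K : ℕ) : ℝ) + 1) * Real.exp (-(δ * tdistT M y y')))) := by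
  obtain ⟨β₁, δ₁, hβ₁, hδ₁, H₁⟩ := hasMaj_kingSOp (d := d) L hLodd hL ha hm0
  obtain ⟨β₂, δ₂, hβ₂, hδ₂, H₂⟩ := hasMaj_kingSOp_fine (d := d) L hLodd hL ha hm0
  obtain ⟨β₃, δ₃, hβ₃, hδ₃, H₃⟩ := hasMaj_idef_tensorId_kingSOp (d := d) L hLodd hL ha hm0 hγ0 hγ1
  obtain ⟨β₄, δ₄, hβ₄, hδ₄, H₄⟩ := hasMaj_tensorId_kingSOpFwd_coarse (d := d) hLodd hL ha hm0
  obtain ⟨β₅, δ₅, hβ₅, hδ₅, H₅⟩ := hasMaj_tensorId_kingSOpFwd_fine (d := d) hLodd hL ha hm0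
  obtain ⟨β₆, δ₆, hβ₆, hδ₆, H₆⟩ := hasMaj_idef_tensorId_kingSOpFwd (d := d) hLodd hL ha hm0 hγ0 hγ1
  obtain ⟨δ₇, β₇, hδ₇, hβ₇, H₇⟩ := hasMaj_kingSOpFwd_comp_idef_mulOp_blockAvg (d := d) hLodd hL ha hm0
  obtain ⟨β₈, δ₈, hβ₈, hδ₈, H₈⟩ := hasMaj_sD_tensorId_kingSOp (d := d) hLodd hL ha hm0
  -- one rate, one constant
  obtain ⟨δ, hδ⟩ : ∃ δ : ℝ, δ = min (min (min δ₁ δ₂) (min δ₃ δ₄)) (min (min δ₅ δ₆) (min δ₇ δ₈)) := ⟨_, rfl⟩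
  have hδpos : 0 < δ := by rw [hδ]; exact lt_min (lt_min (lt_min hδ₁ hδ₂) (lt_min hδ₃ hδ₄)) (lt_min (lt_min hδ₅ hδ₆) (lt_min hδ₇ hδ₈))
  have e₁ : δ ≤ δ₁ := by rw [hδ]; exact le_trans (min_le_left _ _) (le_trans (min_le_left _ _) (min_le_left _ _))
  have e₂ : δ ≤ δ₂ := by rw [hδ]; exact le_trans (min_le_left _ _) (le_trans (min_le_left _ _) (min_le_right _ _))
  have e₃ : δ ≤ δ₃ := by rw [hδ]; exact le_trans (min_le_left _ _) (le_trans (min_le_right _ _) (min_le_left _ _))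
  have e₄ : δ ≤ δ₄ := by rw [hδ]; exact le_trans (min_le_left _ _) (le_trans (min_le_right _ _) (min_le_right _ _))
  have e₅ : δ ≤ δ₅ := by rw [hδ]; exact le_trans (min_le_right _ _) (le_trans (min_le_left _ _) (min_le_left _ _))
  have e₆ : δ ≤ δ₆ := by rw [hδ]; exact le_trans (min_le_right _ _) (le_trans (min_le_left _ _) (min_le_right _ _))
  have e₇ : δ ≤ δ₇ := by rw [hδ]; exact le_trans (min_le_right _ _) (le_trans (min_le_right _ _) (min_le_left _ _))
  have e₈ : δ ≤ δ₈ := by rw [hδ]; exact le_trans (min_le_right _ _) (le_trans (min_le_right _ _) (min_le_right _ _))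
  obtain ⟨β, hβ⟩ : ∃ β : ℝ, β = β₁ + β₂ + β₃ + β₄ + β₅ + β₆ + β₇ + β₈ := ⟨_, rfl⟩
  have hβpos : 0 < β := by rw [hβ]; positivity
  have b₁ : β₁ ≤ β := by rw [hβ]; linarith
  have b₂ : β₂ ≤ β := by rw [hβ]; linarith
  have b₃ : β₃ ≤ β := by rw [hβ]; linarith
  have b₄ : β₄ ≤ β := by rw [hβ]; linarith
  have b₅ : β₅ ≤ β := by rw [hβ]; linarith
  have b₆ : β₆ ≤ β := by rw [hβ]; linarith
  have b₇ : β₇ ≤ β := by rw [hβ]; linarith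
  have b₈ : β₈ ≤ β := by rw [hβ]; linarith
  refine ⟨δ, β, hδpos, hβpos, fun K hK n hn e M _ hM msq hmsq hcap => ⟨?_, ?_, ?_, ?_, ?_, ?_, ?_, ?_⟩⟩
  · intro κ
    have h := hasMaj_tensorId (Fin (d + 1)) (fun y y' => mul_nonneg hβ₁.le (Real.exp_nonneg _)) (H₁ K hK e M hM msq hmsq hcap 1 κ)
    exact hasMaj_weaken L hβ₁.le b₁ e₁ h
  · intro κ
    have h1 := H₂ K hK n e M hM msq hmsq hcap 1 κ
    rw [blockOf_comp_underPtN] at h1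
    have h := hasMaj_tensorId (Fin (d + 1)) (fun y y' => mul_nonneg hβ₂.le (Real.exp_nonneg _)) h1
    exact hasMaj_weaken L hβ₂.le b₂ e₂ h
  · intro κ
    have hθ : 0 ≤ ((L : ℝ) ^ K) ^ (-(γ / 2)) := Real.rpow_nonneg (pow_nonneg (Nat.cast_nonneg _) _) _
    exact hasMaj_weaken₂ L hβ₃.le b₃ hθ e₃ (H₃ K hK n hn e M hM msq hmsq hcap κ)
  · intro μ
    exact hasMaj_weaken L hβ₄.le b₄ e₄ (H₄ K hK e M hM msq hmsq hcap μ)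
  · intro μ
    exact hasMaj_weaken L hβ₅.le b₅ e₅ (H₅ K hK n e M hM msq hmsq hcap μ)
  · intro μ
    have hθ : 0 ≤ ((L : ℝ) ^ K) ^ (-(γ / 2)) := Real.rpow_nonneg (pow_nonneg (Nat.cast_nonneg _) _) _
    exact hasMaj_weaken₂ L hβ₆.le b₆ hθ e₆ (H₆ K hK n hn e M hM msq hmsq hcap μ)
  · intro μ c' r hr hc'
    have hw : 0 ≤ r * ((L ^ K : ℕ) : ℝ) ^ (-(1 / (8 * ((d : ℝ) + 1)))) := mul_nonneg hr (Real.rpow_nonneg (Nat.cast_nonneg _) _)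
    have h := H₇ K hK n e M hM msq hmsq hcap μ c' r hr hc'
    have h' : HasMaj (BlockNorm.ofBlocks (unitTorusGeo L K M) (blkFine L K M))
        (BlockNorm.ofBlocks (unitTorusGeo L K M) (fun p : Tor (fine (L ^ n * L ^ K) M) × Fin (d + 1) => blockOf (L ^ n * L ^ K) M p.1))
        (tensorId (Fin (d + 1)) (kingGOp L a msq (K + n) (L ^ n * L ^ K) M ∘ₗ
            (((L ^ n * L ^ K : ℕ) : ℝ) • (pull (fun y : Tor (fine (L ^ n * L ^ K) M) => y + unitVec (fine (L ^ n * L ^ K) M) μ) - LinearMap.id))) ∘ₗ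
          idef (pull (kingPrV L K n M)) (pull (kingPrV L K n M)) (mulOp c') (mulOp (blockAvg (kingPrV L K n M) c')))
        (fun y y' => β₇ * (r * ((L ^ K : ℕ) : ℝ) ^ (-(1 / (8 * ((d : ℝ) + 1))))) * Real.exp (-(δ₇ * tdistT M y y'))) :=
      h.mono fun y y' => le_of_eq (by ring)
    exact (hasMaj_weaken₂ L hβ₇.le b₇ hw e₇ h').mono fun y y' => le_of_eq (by ring)
  · intro μ μ'
    have hw : 0 ≤ ((K : ℕ) : ℝ) + 1 := by positivity
    exact hasMaj_weaken₂ L hβ₈.le b₈ hw e₈ (H₈ K hK e M hM msq hmsq hcap μ μ')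

end Summit.QuantumFields.YangMills.BalabanUVNodes.N15.KingModel.SrcDiv
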